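import Summits.AtomisticToContinuum.FouriersLaw.Theses.HonestZwanzig

/-!
# Sketch — crux-ideate stmt-AtomisticToContinuum-12694 (HonestZwanzig.PositiveMemory), round 1, ideator 1

First lemmas of the two idea cards, stated over the tree's declarations (pinnedChain,
OscillatorChain.gibbsMeasure, OscillatorChain.transitionKernel, bondCurrent, hamiltonian) with the
route's `corr / lap / e / G / schur` gadgets packaged once as sketch-local abbreviations.
Nothing here is proved; every `def … : Prop` only has to elaborate.

* Card A `flat-dc-covariance-subsequence-floor`:
  `FlatZeroFrequencyCovariance`, `GreenKuboNotInsulating` (transfer target C⁺_A),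
  `subsequenceFloor_shape` (the composition the line would prove).
* Card B `cubic-energy-relaxation-feshbach-cauchy-schwarz`:
  `EnergyMomentIdentities`, `FeshbachCauchySchwarz`, `EnergyRelaxationCubic` (transfer target C⁺_B),
  `FirstMomentLocality`, `cubicRelaxation_shape`.
-/

noncomputable section

open MeasureTheory Filter Set
open scoped BigOperators Topology

namespace Summit.AtomisticToContinuum.FouriersLaw.Cruxes.PositiveMemory.Ideator1

open Literature.MathematicalPhysics.KineticTheory.HeatConduction

/-! ### The route's gadgets, packaged -/

/-- Equilibrium covariance function `corr(f,g)(t) = ∫ f·(P_t g) dμ − μ(f)μ(g)` of the N-chain with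
both baths at `T` (verbatim the route's `corr`). -/
def corrF (ω₂ lam β γ T : ℝ) (N : ℕ) (f g : PhaseSpace N → ℝ) (t : ℝ) : ℝ :=
  (∫ z, f z * (∫ y, g y ∂((pinnedChain ω₂ lam β γ).transitionKernel N T T t.toNNReal z))
      ∂((pinnedChain ω₂ lam β γ).gibbsMeasure N T)) -
    (∫ z, f z ∂((pinnedChain ω₂ lam β γ).gibbsMeasure N T)) *
      (∫ z, g z ∂((pinnedChain ω₂ lam β γ).gibbsMeasure N T))

/-- Static covariance under the Gibbs measure (the route's `cov`). -/
def covF (ω₂ lam β γ T : ℝ) (N : ℕ) (f g : PhaseSpace N → ℝ) : ℝ :=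
  (∫ z, f z * g z ∂((pinnedChain ω₂ lam β γ).gibbsMeasure N T)) -
    (∫ z, f z ∂((pinnedChain ω₂ lam β γ).gibbsMeasure N T)) *
      (∫ z, g z ∂((pinnedChain ω₂ lam β γ).gibbsMeasure N T))

/-- Laplace transform `lap_s(f,g) = ∫₀^∞ e^{-st} corr(f,g)(t) dt` (the route's `lap`). -/
def lapF (ω₂ lam β γ T : ℝ) (N : ℕ) (s : ℝ) (f g : PhaseSpace N → ℝ) : ℝ :=
  ∫ t in Ioi (0 : ℝ), Real.exp (-(s * t)) * corrF ω₂ lam β γ T N f g t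

/-- `k`-th time moment `∫₀^∞ t^k corr(f,g)(t) dt`. -/
def momF (ω₂ lam β γ T : ℝ) (N : ℕ) (k : ℕ) (f g : PhaseSpace N → ℝ) : ℝ :=
  ∫ t in Ioi (0 : ℝ), t ^ k * corrF ω₂ lam β γ T N f g t

/-- Symmetrically split site energy `e_x` (the route's `e`). -/
def siteE (ω₂ lam β γ : ℝ) (N : ℕ) (x : Fin N) (z : PhaseSpace N) : ℝ :=
  z.2 x ^ 2 / 2 + (pinnedChain ω₂ lam β γ).U (z.1 x) +
    ∑ j : Fin N, ((if j.val = x.val + 1 then (pinnedChain ω₂ lam β γ).V (z.1 j - z.1 x) / 2 else 0) +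
      (if x.val = j.val + 1 then (pinnedChain ω₂ lam β γ).V (z.1 x - z.1 j) / 2 else 0))

/-- Energy block of the resolvent `G(s)_{xy} = lap_s(e_x, e_y)` (the route's `G`). -/
def Gmat (ω₂ lam β γ T : ℝ) (N : ℕ) (s : ℝ) : Matrix (Fin N) (Fin N) ℝ :=
  Matrix.of fun x y => lapF ω₂ lam β γ T N s (siteE ω₂ lam β γ N x) (siteE ω₂ lam β γ N y)

/-- Schur complement `schur_s(f,g) = lap_s(f,g) − lap_s(f,e) G(s)⁻¹ lap_s(e,g)` = resolvent form of
Zwanzig's orthogonal dynamics (the route's `schur`). -/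
def schurF (ω₂ lam β γ T : ℝ) (N : ℕ) (s : ℝ) (f g : PhaseSpace N → ℝ) : ℝ :=
  lapF ω₂ lam β γ T N s f g -
    ∑ x : Fin N, ∑ y : Fin N, lapF ω₂ lam β γ T N s f (siteE ω₂ lam β γ N x) *
      (Gmat ω₂ lam β γ T N s)⁻¹ x y * lapF ω₂ lam β γ T N s (siteE ω₂ lam β γ N y) g

/-- Total current `J = Σ_b j_b`. -/
def totalJ (ω₂ lam β γ : ℝ) (N : ℕ) (z : PhaseSpace N) : ℝ :=
  ∑ i : Fin N, (pinnedChain ω₂ lam β γ).bondCurrent N i z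

/-- Weighted current `J_η = Σ_b η_b j_b` for a bond vector `η`. -/
def weightedJ (ω₂ lam β γ : ℝ) (N : ℕ) (η : Fin N → ℝ) (z : PhaseSpace N) : ℝ :=
  ∑ b : Fin N, η b * (pinnedChain ω₂ lam β γ).bondCurrent N b z

/-- Discrete gradient of a site profile, as a bond vector: `(∇ζ)_b = ζ_{b+1} − ζ_b` (0 on the phantom
bond `b = N−1`). -/
def gradProfile (N : ℕ) (ζ : Fin N → ℝ) (b : Fin N) : ℝ :=
  ∑ j : Fin N, if j.val = b.val + 1 then ζ j - ζ b else 0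

/-- Contact kinetic-temperature fluctuation `w = p_0² + p_{N−1}² − 2T` (so that `L H = −γ w`,
BLR eq. (25) / `generator_hamiltonian_two_baths`). -/
def contactW (N : ℕ) (T : ℝ) (z : PhaseSpace N) : ℝ :=
  ∑ i : Fin N, ((if i.val = 0 then z.2 i ^ 2 - T else 0) + (if i.val = N - 1 then z.2 i ^ 2 - T else 0))

/-! ### Card A — flat zero-frequency covariance and the subsequence floor -/

/-- FIRST LEMMA of card A (bond×bond form of Kundu–Dhar–Narayan's continuity step, arXiv:0809.4543
p. 4, `dD_l/dt = −2 j_{l+1,l} + 2 J_b`): at fixed `N` the zero-frequency bond-current covariance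
matrix of the FULL dynamics is constant — `lap_s(j_b, j_{b'}) − lap_s(j_0, j_0) → 0` as `s ↓ 0`
for all genuine bonds `b, b'`. Inputs: GeneratorSiteEnergy, ParityStatics, FeshbachIdentities
(i)–(iii) (Kolmogorov identity in the first slot + time reversal). -/
def FlatZeroFrequencyCovariance : Prop :=
  ∀ ω₂ lam β γ : ℝ, 0 < ω₂ → 0 < lam → 0 < β → 0 < γ → ∀ T : ℝ, 0 < T → ∀ N : ℕ, ∀ hN : 2 ≤ N,
    ∀ b b' : Fin N, b.val + 1 < N → b'.val + 1 < N →
      Tendsto (fun s => lapF ω₂ lam β γ T N s ((pinnedChain ω₂ lam β γ).bondCurrent N b)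
          ((pinnedChain ω₂ lam β γ).bondCurrent N b') -
        lapF ω₂ lam β γ T N s ((pinnedChain ω₂ lam β γ).bondCurrent N ⟨0, by omega⟩)
          ((pinnedChain ω₂ lam β γ).bondCurrent N ⟨0, by omega⟩))
        (𝓝[>] (0 : ℝ)) (𝓝 0)

/-- TRANSFER TARGET C⁺_A (`GreenKuboNotInsulating`, equilibrium form of "no perfect insulator along
a subsequence"): the equilibrium total-current Green–Kubo integral is extensive along SOME sequence
of lengths — `∃ c > 0, ∀ N₀, ∃ N ≥ N₀, c·(N−1) ≤ ∫₀^∞ corr(J,J)`. Via OpenChainGreenKubo this is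
`limsup_N D_N > 0`, strictly weaker than ConductanceLowerBound (stmt-11749, liminf) and than the
conjunct's `κ > 0`. -/
def GreenKuboNotInsulating : Prop :=
  ∀ ω₂ lam β γ : ℝ, 0 < ω₂ → 0 < lam → 0 < β → 0 < γ → ∀ T : ℝ, 0 < T →
    ∃ c : ℝ, 0 < c ∧ ∀ N₀ : ℕ, ∃ N : ℕ, N₀ ≤ N ∧
      c * ((N : ℝ) - 1) ≤ ∫ t in Ioi (0 : ℝ), corrF ω₂ lam β γ T N (totalJ ω₂ lam β γ N) (totalJ ω₂ lam β γ N) t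

/-- The free Schur inequality for odd observables, specialised: `schur_s(J,J) ≥ lap_s(J,J)` for
`s > 0` (time reversal makes `G(s)` symmetric and `lap_s(e_x,J) = −lap_s(J,e_x)`; refuter rattack
note on the item). Support-level. -/
def SchurDominatesLap : Prop :=
  ∀ ω₂ lam β γ : ℝ, 0 < ω₂ → 0 < lam → 0 < β → 0 < γ → ∀ T : ℝ, 0 < T → ∀ N : ℕ, 2 ≤ N →
    ∀ s : ℝ, 0 < s →
      lapF ω₂ lam β γ T N s (totalJ ω₂ lam β γ N) (totalJ ω₂ lam β γ N) ≤
        schurF ω₂ lam β γ T N s (totalJ ω₂ lam β γ N) (totalJ ω₂ lam β γ N)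

/-- Shape of the line of card A: with the route's crux OrthogonalOhm (registered dep of
PositiveMemory) and the support-level inequality, the transfer target closes the crux. (The fixed-N
package FeshbachIdentities supplies `lap_s(J,J) → ∫₀^∞corr(J,J)` as `s ↓ 0`.) -/
theorem subsequenceFloor_shape :
    Theses.HonestZwanzig.FeshbachIdentities → SchurDominatesLap →
      Theses.HonestZwanzig.OrthogonalOhm → GreenKuboNotInsulating →
        Theses.HonestZwanzig.PositiveMemory := by
  sorry

/-! ### Card B — cubic energy relaxation and the Feshbach Cauchy–Schwarz inequality -/

/-- FIRST LEMMA of card B, part 1 (three exact moment identities at fixed `N ≥ 2`, from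
`L H = −γ w` and the two Kolmogorov identities of FeshbachIdentities (iii)):
(0) `γ ∫₀^∞ corr(w,w) = 2T²` (escape sum rule, known), (1) `γ² ∫₀^∞ t·corr(w,w) = Var_μ(H)`
(first-moment rule = OneThirdTimeLag's `C_near + C_far = Var(H)/(2T²)`), (2) NEW:
`∫₀^∞ corr(H,H) = (γ²/2) ∫₀^∞ t²·corr(w,w)` — the time-integrated total-energy autocorrelation is
the SECOND time moment of the contact-temperature autocorrelation. -/
def EnergyMomentIdentities : Prop :=
  ∀ ω₂ lam β γ : ℝ, 0 < ω₂ → 0 < lam → 0 < β → 0 < γ → ∀ T : ℝ, 0 < T → ∀ N : ℕ, 2 ≤ N →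
    let H : PhaseSpace N → ℝ := (pinnedChain ω₂ lam β γ).hamiltonian N
    let w : PhaseSpace N → ℝ := contactW N T
    IntegrableOn (fun t => t ^ 2 * corrF ω₂ lam β γ T N w w t) (Ioi 0) ∧
    IntegrableOn (corrF ω₂ lam β γ T N H H) (Ioi 0) ∧
    γ * momF ω₂ lam β γ T N 0 w w = 2 * T ^ 2 ∧
    γ ^ 2 * momF ω₂ lam β γ T N 1 w w = covF ω₂ lam β γ T N H H ∧
    ∫ t in Ioi (0 : ℝ), corrF ω₂ lam β γ T N H H t = γ ^ 2 / 2 * momF ω₂ lam β γ T N 2 w w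

/-- FIRST LEMMA of card B, part 2 (the lever; exact at every `s > 0`, fixed `N ≥ 2`): for every site
profile `ζ` vanishing at both contact sites,
`Cov(H, E_ζ)² ≤ lap_s(H,H) · (s·Var(E_ζ) + schur_s(J_{∇ζ}, J_{∇ζ}))`, `E_ζ = Σ ζ_x e_x`,
`J_{∇ζ} = Σ_b (ζ_{b+1} − ζ_b) j_b` — Cauchy–Schwarz `(𝟙ᵀχζ)² ≤ (𝟙ᵀG𝟙)(ζᵀχG⁻¹χζ)` for the
symmetric positive-definite energy block `G(s)` (FeshbachIdentities (ii),(iv)), with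
`χG(s)⁻¹χ = 𝔽(s)` and `ζᵀ𝔽(s)ζ = s·Var(E_ζ) + schur_s(J_{∇ζ},J_{∇ζ})` when `ζ_0 = ζ_{N−1} = 0`
(GeneratorSiteEnergy + ParityStatics: the contact rows drop). -/
def FeshbachCauchySchwarz : Prop :=
  ∀ ω₂ lam β γ : ℝ, 0 < ω₂ → 0 < lam → 0 < β → 0 < γ → ∀ T : ℝ, 0 < T → ∀ N : ℕ, 2 ≤ N →
    ∀ s : ℝ, 0 < s → ∀ ζ : Fin N → ℝ, (∀ x : Fin N, (x.val = 0 ∨ x.val = N - 1) → ζ x = 0) →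
      let H : PhaseSpace N → ℝ := (pinnedChain ω₂ lam β γ).hamiltonian N
      let Eζ : PhaseSpace N → ℝ := fun z => ∑ x : Fin N, ζ x * siteE ω₂ lam β γ N x z
      let Jη : PhaseSpace N → ℝ := weightedJ ω₂ lam β γ N (gradProfile N ζ)
      covF ω₂ lam β γ T N H Eζ ^ 2 ≤
        lapF ω₂ lam β γ T N s H H * (s * covF ω₂ lam β γ T N Eζ Eζ + schurF ω₂ lam β γ T N s Jη Jη)

/-- TRANSFER TARGET C⁺_B (`EnergyRelaxationCubic`): the time-integrated autocorrelation of the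
TOTAL ENERGY of the equilibrium thermostatted chain is at most cubic in the length,
`∫₀^∞ Cov_μ(H(0),H(t)) dt ≤ C(T)·N³` — i.e. the energy autocorrelation time is at most the
diffusive Thouless time `≍ N²`. Regime-blind: harmonic member `≈ 0.58·T²N³/γ` at (ω₂,γ,T)=(1,1.3,0.7) (zone-boundary
phonons; exact Gaussian job j015277, N ≤ 80), diffusive chain `≈ c_v²T⁴N³/(12 k)` (hydrodynamics); fails exactly for insulators. By
`EnergyMomentIdentities` it is the bound `M₂(N) ≤ 2C N³/γ²` on the second time moment of the
contact-temperature autocorrelation. -/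
def EnergyRelaxationCubic : Prop :=
  ∀ ω₂ lam β γ : ℝ, 0 < ω₂ → 0 < lam → 0 < β → 0 < γ → ∀ T : ℝ, 0 < T → ∃ C : ℝ, ∀ N : ℕ, 2 ≤ N →
    let H : PhaseSpace N → ℝ := (pinnedChain ω₂ lam β γ).hamiltonian N
    IntegrableOn (corrF ω₂ lam β γ T N H H) (Ioi 0) ∧
      ∫ t in Ioi (0 : ℝ), corrF ω₂ lam β γ T N H H t ≤ C * (N : ℝ) ^ 3

/-- Quantitative locality slot used by the form-to-row-sum bridge (a child of OrthogonalOhm's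
foreseen split `UniformLocality`, here with a summable FIRST moment): the zero-frequency bond memory
`𝔎_N(s)_{bb'} = schur_s(j_b, j_{b'})` has `sup_b Σ_{b'} |b − b'|·|𝔎_{bb'}| ≤ M` for small `s`,
uniformly in `N`. -/
def FirstMomentLocality : Prop :=
  ∀ ω₂ lam β γ : ℝ, 0 < ω₂ → 0 < lam → 0 < β → 0 < γ → ∀ T : ℝ, 0 < T → ∃ M : ℝ, ∀ N : ℕ, 2 ≤ N →
    ∃ s₀ : ℝ, 0 < s₀ ∧ ∀ s : ℝ, 0 < s → s < s₀ → ∀ b : Fin N,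
      ∑ b' : Fin N, |((b : ℝ) - (b' : ℝ))| *
        |schurF ω₂ lam β γ T N s ((pinnedChain ω₂ lam β γ).bondCurrent N b)
          ((pinnedChain ω₂ lam β γ).bondCurrent N b')| ≤ M

/-- A static input (positive bulk specific heat per site): `Cov_μ(H, e_x) ≥ c₀ T²` at every site of
every chain (kinetic part alone gives `T²/2`; the potential part is the bet `c₀ ≤ 1/2` allows for). -/
def SiteHeatCapacityFloor : Prop :=
  ∀ ω₂ lam β γ : ℝ, 0 < ω₂ → 0 < lam → 0 < β → 0 < γ → ∀ T : ℝ, 0 < T → ∃ c₀ : ℝ, 0 < c₀ ∧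
    ∀ N : ℕ, 2 ≤ N → ∀ x : Fin N,
      c₀ * T ^ 2 ≤ covF ω₂ lam β γ T N ((pinnedChain ω₂ lam β γ).hamiltonian N) (siteE ω₂ lam β γ N x)

/-- Shape of the line of card B: the fixed-N identities and the Cauchy–Schwarz lever turn the cubic
energy-relaxation bound into `⟨η, 𝔎η⟩ ≥ c N³` on the parabola gradient `η_b = N − 2 − 2b`; the
first-moment locality slot and OrthogonalOhm (registered dep) turn form-coercivity into row-sum
positivity `ρ_b ≥ k₀`. -/
theorem cubicRelaxation_shape :
    Theses.HonestZwanzig.FeshbachIdentities → EnergyMomentIdentities → FeshbachCauchySchwarz →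
      SiteHeatCapacityFloor → EnergyRelaxationCubic → FirstMomentLocality →
        Theses.HonestZwanzig.OrthogonalOhm → Theses.HonestZwanzig.PositiveMemory := by
  sorry

end Summit.AtomisticToContinuum.FouriersLaw.Cruxes.PositiveMemory.Ideator1

end
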